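import Summits.QuantumFields.YangMills.Theorems.BalabanUVNodesN19NoLinearPrice
import Summits.QuantumFields.YangMills.Theorems.BalabanUVNodesN19ExpectationCurrencyTwoConstants
import Mathlib.Analysis.SpecialFunctions.Pow.Real
import Mathlib.Analysis.SpecialFunctions.Log.PosLog

/-!
# YM-DAG node N19 (= NE7 proper) — THE PRICE OF THE EXPECTATION CURRENCY IS INTRINSICALLY SUPER-LINEAR, III: the exponent `1` of the
# logarithm in the lineage's linear-log price cannot be lowered

Cell `pub-ymgap`, HUMAN RULING D-0062 (Track A), R141 (C) wider-strategy seat `pub-ymgap-dag-n19-e` (strategy s3 = ALTERNATIVE CURRENCY),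
generation g10, third module (siblings `…Theorems.BalabanUVNodesN19NoLinearPriceWitness` p509390 and `…Theorems.BalabanUVNodesN19NoLinearPrice`,
filed right before).  Route `Summits/QuantumFields/YangMills/Theses/BalabanUVNodes.lean` rev 19, cluster item K3⁗ «SpineGivenEndpointR13Sep»
(stmt-QuantumFields-20292); filed `--supports` that item `--as helper` (it proves no registered stub).  COUNT-NEUTRAL: elementary real analysis over
Mathlib (`Real.rpow`, `Real.log_le_rpow_div`, `Real.posLog`) on top of module II; imports the seat's p480837
`…Theorems.BalabanUVNodesN19ExpectationCurrencyTwoConstants` only so that the theorem whose optimality is asserted is in scope BY NAME (nothing of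
it is used in a proof); no scheme object, no Theses import; NOT a discharge claim.

THE RESULT.  p480837 `abs_integral_sub_integral_le_linlog_of_cgf_close`: two probability spaces, observables `|X|, |Y| ≤ B` a.e., cgf's `ε`-close
on `|t| < l₀` ⇒ `|∫Y dν − ∫X dμ| ≤ 4e^{1+l₀B}·ε·(1 + log⁺ ε⁻¹)∕l₀`.  ★★ `linlog_exponent_one_sharp`: for every window `0 < l₀`, every exponent
`a < 1` and every constant `C` there are two probability laws on `[0, 1]` (`X = Y = id`, `B = 1`) and `ε > 0` with cgf's `ε`-close on the CLOSED
window `|t| ≤ l₀` and `|E_ν − E_μ| > C·ε·(1 + log⁺ ε⁻¹)^a` — the exponent `1` of the logarithm cannot be lowered, for any constant; in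
particular «√log» (HANDOFF v5 (b′)) is refuted.  PROOF: module II's family at odd `M` has cgf's `ε`-close with
`e^{l₀}·2(1 + 4M∕l₀)^{−M} ≤ ε`, hence `log⁺ ε⁻¹ ≤ M·log(1 + 4M∕l₀)`, and `|ΔE| ≥ (M·e^{−2l₀}∕l₀)·ε`; §7 (`exists_odd_gt_linlog_rpow`) picks `M` with
`C·l₀e^{2l₀}·(1 + M·log(1 + 4M∕l₀))^{a′} < M`, `a′ = max a ½`, using `log x ≤ x^η∕η` (`η = (1−a′)∕(2a′)`) to bound the left side by
`K·K₁^{a′}·M^{(1+a′)∕2}`.  WHAT STAYS OPEN (honest): the `log log` between `|ΔE|∕ε ≳ log ε⁻¹ ∕ log log ε⁻¹` (this family: `M` grid points are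
needed to carry a degree-`M` Chebyshev polynomial, so `log ε⁻¹ ≈ M log M` while the gain is `≈ M`) and `≲ log ε⁻¹` (p480837); a family without
the `log log` would need non-grid (continuous-density) extremal signed measures — not attempted (real reason: no Mathlib path to the
Paley–Wiener ∕ Beurling–Malliavin extremal theory it rests on).

HONEST FRAMING (binding).  Elementary; NO consumer in the DAG today (the apex consumes existence of limits, not rates); value = optimality
certificate for the lineage's rate theorems (p480837 ∕ p481156 ∕ p482030) and for the planner's choice of currency in the K3 rate stubs
(`stub_rates13`: a rate carried as «cgf-matching mod constants `δ_K` on a window» converts to expectation rates only at the price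
`δ_K·log δ_K⁻¹`, never `δ_K`).  Nothing of Bałaban's is instantiated; NE7 ∕ NE7b ∕ NE7c NOT PRINTED, NOT proved; N19 NOT discharged; count-neutral.
One finite `T⁴` programme at fixed `ε`; nothing continuum ∕ `ℝ⁴` ∕ OS ∕ mass-gap ∕ Clay.
-/

noncomputable section

open Real Finset MeasureTheory ProbabilityTheory

namespace Summit.QuantumFields.YangMills.Theorems.BalabanUVNodesN19NoLinearPriceSharp

open Summit.QuantumFields.YangMills.Theorems.BalabanUVNodesN19NoLinearPrice

/-! ## §7 Growth: `M·log(1 + cM)` raised to a power `a < 1` is eventually below `M∕K` -/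

/-- For `0 < a < 1`, every `K` and every `c ≥ 0` there is an odd `M` with `K·(1 + M·log(1 + c·M))^a < M`
(`log x ≤ x^η∕η` with `η = (1 − a)∕(2a)`, so the left side is `≤ K·K₁^a·M^{(1+a)∕2}`). [folklore] -/
theorem exists_odd_gt_linlog_rpow {a : ℝ} (ha0 : 0 < a) (ha1 : a < 1) (K : ℝ) {c : ℝ} (hc : 0 ≤ c) :
    ∃ M : ℕ, Odd M ∧ K < M ∧ K * (1 + M * log (1 + c * M)) ^ a < M := by
  -- the case `K ≤ 0` is trivial
  rcases le_or_gt K 0 with hK | hK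
  · refine ⟨1, odd_one, by norm_num; linarith, ?_⟩
    have hb : 0 ≤ (1 + (1 : ℕ) * log (1 + c * (1 : ℕ))) ^ a :=
      rpow_nonneg (by norm_num; exact add_nonneg zero_le_one (log_nonneg (by linarith))) a
    calc K * _ ≤ 0 := mul_nonpos_of_nonpos_of_nonneg hK hb
      _ < (1 : ℕ) := by norm_num
  set η : ℝ := (1 - a) / (2 * a) with hη
  have hη0 : 0 < η := div_pos (by linarith) (by linarith)
  set K₁ : ℝ := 1 + (1 + c) ^ η / η with hK₁
  have hK₁0 : 0 < K₁ := by positivity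
  have hKK : 0 ≤ K * K₁ ^ a := by positivity
  obtain ⟨k, hk⟩ := exists_nat_gt (max K ((K * K₁ ^ a) ^ (2 / (1 - a))))
  refine ⟨2 * k + 1, odd_two_mul_add_one k, ?_, ?_⟩
  · calc K ≤ max K _ := le_max_left _ _
      _ < k := hk
      _ ≤ (2 * k + 1 : ℕ) := by push_cast; linarith
  set M : ℝ := ((2 * k + 1 : ℕ) : ℝ) with hM
  have hkM : (k : ℝ) ≤ M := by rw [hM]; push_cast; linarith
  have hM1 : 1 ≤ M := by rw [hM]; exact_mod_cast Nat.le_add_left 1 (2 * k)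
  have hM0 : 0 < M := by linarith
  -- `log(1 + cM) ≤ (1+c)^η M^η / η`
  have hlog : log (1 + c * M) ≤ (1 + c) ^ η / η * M ^ η := by
    calc log (1 + c * M) ≤ (1 + c * M) ^ η / η := log_le_rpow_div (by positivity) hη0
      _ ≤ ((1 + c) * M) ^ η / η := by
          gcongr
          nlinarith
      _ = (1 + c) ^ η / η * M ^ η := by rw [mul_rpow (by positivity) hM0.le]; ring
  have hlog0 : 0 ≤ log (1 + c * M) := log_nonneg (by nlinarith)
  -- `1 + M log(1+cM) ≤ K₁ M^{1+η}`
  have hM1η : 1 ≤ M ^ (1 + η) := one_le_rpow hM1 (by positivity)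
  have hlin : 1 + M * log (1 + c * M) ≤ K₁ * M ^ (1 + η) := by
    calc 1 + M * log (1 + c * M) ≤ 1 + M * ((1 + c) ^ η / η * M ^ η) := by gcongr
      _ = 1 + (1 + c) ^ η / η * M ^ (1 + η) := by rw [rpow_add hM0, rpow_one]; ring
      _ ≤ K₁ * M ^ (1 + η) := by
          rw [hK₁, add_mul, one_mul]
          gcongr
  -- raise to the power `a` and split `M = M^{(1−a)/2} · M^{(1+a)/2}`
  have hpow : (1 + M * log (1 + c * M)) ^ a ≤ K₁ ^ a * M ^ ((1 + a) / 2) := by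
    calc (1 + M * log (1 + c * M)) ^ a ≤ (K₁ * M ^ (1 + η)) ^ a := rpow_le_rpow (by positivity) hlin ha0.le
      _ = K₁ ^ a * (M ^ (1 + η)) ^ a := mul_rpow hK₁0.le (by positivity)
      _ = K₁ ^ a * M ^ ((1 + a) / 2) := by
          rw [← rpow_mul hM0.le]
          congr 2
          rw [hη]
          field_simp
          ring
  have hkey : K * K₁ ^ a < M ^ ((1 - a) / 2) := by
    have hlt : (K * K₁ ^ a) ^ (2 / (1 - a)) < M := ((le_max_right _ _).trans_lt hk).trans_le hkM
    have h := rpow_lt_rpow (by positivity) hlt (by apply div_pos <;> linarith : 0 < (1 - a) / 2)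
    have hne : (1 - a) ≠ 0 := (sub_pos.mpr ha1).ne'
    rwa [← rpow_mul hKK, show 2 / (1 - a) * ((1 - a) / 2) = 1 by field_simp, rpow_one] at h
  have hsplit : M ^ ((1 - a) / 2) * M ^ ((1 + a) / 2) = M := by
    rw [← rpow_add hM0, show (1 - a) / 2 + (1 + a) / 2 = 1 by ring, rpow_one]
  calc K * (1 + M * log (1 + c * M)) ^ a ≤ K * (K₁ ^ a * M ^ ((1 + a) / 2)) := mul_le_mul_of_nonneg_left hpow hK.le
    _ = K * K₁ ^ a * M ^ ((1 + a) / 2) := by ring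
    _ < M ^ ((1 - a) / 2) * M ^ ((1 + a) / 2) := mul_lt_mul_of_pos_right hkey (rpow_pos_of_pos hM0 _)
    _ = M := hsplit

/-! ## §8 The exponent of the logarithm -/

/-- **THE EXPONENT `1` OF THE LOGARITHM IS SHARP.**  The lineage's price (p480837 `abs_integral_sub_integral_le_linlog_of_cgf_close`: two
laws with `|X|, |Y| ≤ B` a.e. and cgf's `ε`-close on `|t| < l₀` have means `4e^{1+l₀B}·ε·(1 + log⁺ ε⁻¹)∕l₀`-close) cannot be improved to
`C·ε·(1 + log⁺ ε⁻¹)^a` for ANY `a < 1` and any `C = C(l₀)`: for every window `0 < l₀`, every `a < 1` and every `C` there are two probability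
laws on `[0, 1]` (the identity observable, `B = 1`) and `ε > 0` with cgf's `ε`-close on the CLOSED window `|t| ≤ l₀` and
`|E_ν − E_μ| > C·ε·(1 + log⁺ ε⁻¹)^a`.  (Along module II's family `log⁺ ε⁻¹ ≤ M·log(1 + 4M∕l₀)` while `|ΔE|∕ε ≥ M·e^{−2l₀}∕l₀`, and §7.)
What stays OPEN: the `log log` between `|ΔE|∕ε ≳ log ε⁻¹∕log log ε⁻¹` (this family) and `≲ log ε⁻¹` (p480837). [folklore] -/
theorem linlog_exponent_one_sharp {l₀ : ℝ} (hl₀ : 0 < l₀) {a : ℝ} (ha : a < 1) (C : ℝ) :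
    ∃ μ ν : Measure ℝ, IsProbabilityMeasure μ ∧ IsProbabilityMeasure ν ∧
      μ (Set.Icc 0 1)ᶜ = 0 ∧ ν (Set.Icc 0 1)ᶜ = 0 ∧
      ∃ ε : ℝ, 0 < ε ∧ (∀ t : ℝ, |t| ≤ l₀ → |cgf id ν t - cgf id μ t| ≤ ε) ∧
        C * ε * (1 + posLog ε⁻¹) ^ a < |∫ x, x ∂ν - ∫ x, x ∂μ| := by
  -- work with the exponent `a' = max a (1/2) ∈ (0, 1)`
  set a' : ℝ := max a (1 / 2) with ha'
  have ha'0 : 0 < a' := lt_of_lt_of_le one_half_pos (le_max_right _ _)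
  have ha'1 : a' < 1 := max_lt ha one_half_lt_one
  obtain ⟨M, hM, hKM, hgrow⟩ :=
    exists_odd_gt_linlog_rpow ha'0 ha'1 (C * l₀ * exp (2 * l₀)) (c := 4 / l₀) (by positivity)
  obtain ⟨μ, ν, iμ, iν, hμ, hν, ε, hε, hlo, -, hwin, hmom⟩ := exists_cgf_close_means_far hl₀ hM
  refine ⟨μ, ν, iμ, iν, hμ, hν, ε, hε, hwin, lt_of_lt_of_le ?_ hmom⟩
  have hMr : (0 : ℝ) < M := Nat.cast_pos.mpr hM.pos
  -- `log⁺ ε⁻¹ ≤ M·log(1 + 4M/l₀)`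
  have hb1 : 1 ≤ 1 + 4 * (M : ℝ) / l₀ := le_add_of_nonneg_right (by positivity)
  have hpl : posLog ε⁻¹ ≤ M * log (1 + 4 / l₀ * M) := by
    have hb : 1 ≤ (1 + 4 * (M : ℝ) / l₀) ^ M := one_le_pow₀ hb1
    have hεinv : ε⁻¹ ≤ (1 + 4 * M / l₀) ^ M := by
      rw [inv_le_comm₀ hε (by positivity)]
      calc ((1 + 4 * (M : ℝ) / l₀) ^ M)⁻¹ ≤ 2 / (1 + 4 * M / l₀) ^ M := by
            rw [div_eq_mul_inv (2 : ℝ)]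
            linarith [inv_nonneg.mpr (zero_le_one.trans hb)]
        _ ≤ exp l₀ * (2 / (1 + 4 * M / l₀) ^ M) :=
            le_mul_of_one_le_left (by positivity) (one_le_exp_iff.mpr hl₀.le)
        _ ≤ ε := hlo
    calc posLog ε⁻¹ ≤ posLog ((1 + 4 * M / l₀) ^ M) := posLog_le_posLog (inv_pos.mpr hε).le hεinv
      _ = log ((1 + 4 * M / l₀) ^ M) := posLog_eq_log (by rwa [abs_of_nonneg (zero_le_one.trans hb)])
      _ = M * log (1 + 4 / l₀ * M) := by rw [log_pow]; ring_nf
  have hbase : 1 ≤ 1 + posLog ε⁻¹ := le_add_of_nonneg_right posLog_nonneg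
  -- the case `C ≤ 0` is trivial
  rcases le_or_gt C 0 with hC | hC
  · calc C * ε * (1 + posLog ε⁻¹) ^ a ≤ 0 :=
          mul_nonpos_of_nonpos_of_nonneg (mul_nonpos_of_nonpos_of_nonneg hC hε.le) (rpow_nonneg (by positivity) a)
      _ < M * exp (-2 * l₀) / l₀ * ε := by positivity
  -- `C·ε·(1+log⁺ε⁻¹)^a ≤ C·ε·(1 + M log(1+4M/l₀))^{a'} < (M e^{−2l₀}/l₀)·ε`
  have hgrow' : C * (1 + M * log (1 + 4 / l₀ * M)) ^ a' < M * exp (-2 * l₀) / l₀ := by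
    have h := mul_lt_mul_of_pos_right hgrow (exp_pos (-2 * l₀))
    have e : C * l₀ * exp (2 * l₀) * (1 + M * log (1 + 4 / l₀ * M)) ^ a' * exp (-2 * l₀) =
        C * (1 + M * log (1 + 4 / l₀ * M)) ^ a' * l₀ := by
      rw [show C * l₀ * exp (2 * l₀) * (1 + M * log (1 + 4 / l₀ * M)) ^ a' * exp (-2 * l₀) =
          C * (1 + M * log (1 + 4 / l₀ * M)) ^ a' * l₀ * (exp (2 * l₀) * exp (-2 * l₀)) by ring,
        ← Real.exp_add, show 2 * l₀ + -2 * l₀ = 0 by ring, Real.exp_zero, mul_one]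
    rw [lt_div_iff₀ hl₀, ← e]
    exact h
  calc C * ε * (1 + posLog ε⁻¹) ^ a ≤ C * ε * (1 + posLog ε⁻¹) ^ a' := by
        gcongr
        exact le_max_left _ _
    _ ≤ C * ε * (1 + M * log (1 + 4 / l₀ * M)) ^ a' := by
        gcongr
    _ = C * (1 + M * log (1 + 4 / l₀ * M)) ^ a' * ε := by ring
    _ < M * exp (-2 * l₀) / l₀ * ε := mul_lt_mul_of_pos_right hgrow' hε

/-! ## §9 The sandwich: the tree's upper bound and this family's lower bound on the same pair -/

/-- **SANDWICH (consistency certificate).**  On module II's pair the tree's linear-log price (p480837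
`abs_integral_sub_integral_le_linlog_of_cgf_close`, instantiated at `X = Y = id`, `B = 1` — its hypotheses `AEMeasurable`, `|·| ≤ 1` a.e.,
cgf's `ε`-close on `|t| < l₀` are all met) and this family's lower bound hold TOGETHER:
`(M·e^{−2l₀}∕l₀)·ε ≤ |E_ν − E_μ| ≤ 4e^{1+l₀}·ε·(1 + log⁺ ε⁻¹)∕l₀` — so along the family `log⁺ ε⁻¹ + 1 ≥ M·e^{−3l₀−1}∕4`: the tree's theorem
FORCES the witnesses' `ε` to be exponentially small in `M`, as module I's `Λ ≥ 2^{M−1}r^{−M}` indeed makes it. [folklore] -/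
theorem witness_sandwich {l₀ : ℝ} (hl₀ : 0 < l₀) {M : ℕ} (hM : Odd M) :
    ∃ μ ν : Measure ℝ, IsProbabilityMeasure μ ∧ IsProbabilityMeasure ν ∧
      μ (Set.Icc 0 1)ᶜ = 0 ∧ ν (Set.Icc 0 1)ᶜ = 0 ∧
      ∃ ε : ℝ, 0 < ε ∧ (∀ t : ℝ, |t| ≤ l₀ → |cgf id ν t - cgf id μ t| ≤ ε) ∧
        M * exp (-2 * l₀) / l₀ * ε ≤ |∫ x, x ∂ν - ∫ x, x ∂μ| ∧
        |∫ x, x ∂ν - ∫ x, x ∂μ| ≤ 4 * exp (1 + l₀ * 1) * ε * (1 + posLog ε⁻¹) / l₀ ∧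
        M * exp (-2 * l₀) / l₀ ≤ 4 * exp (1 + l₀ * 1) * (1 + posLog ε⁻¹) / l₀ := by
  obtain ⟨μ, ν, iμ, iν, hμ, hν, ε, hε, -, -, hwin, hmom⟩ := exists_cgf_close_means_far hl₀ hM
  have hup : |∫ x, x ∂ν - ∫ x, x ∂μ| ≤ 4 * exp (1 + l₀ * 1) * ε * (1 + posLog ε⁻¹) / l₀ := by
    have h := Summit.QuantumFields.YangMills.BalabanUVNodes.N19ExpectationCurrencyTwoConstants.abs_integral_sub_integral_le_linlog_of_cgf_close
      (μ := μ) (ν := ν) (X := id) (Y := id) aemeasurable_id aemeasurable_id (ae_abs_le_one_of_Icc hμ)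
      (ae_abs_le_one_of_Icc hν) hl₀ hε.le fun t ht => hwin t ht.le
    simpa only [id] using h
  refine ⟨μ, ν, iμ, iν, hμ, hν, ε, hε, hwin, hmom, hup, ?_⟩
  -- divide the sandwich by `ε > 0`
  have h := hmom.trans hup
  rw [show 4 * exp (1 + l₀ * 1) * ε * (1 + posLog ε⁻¹) / l₀ = 4 * exp (1 + l₀ * 1) * (1 + posLog ε⁻¹) / l₀ * ε by ring]
    at h
  exact le_of_mul_le_mul_right h hε

end Summit.QuantumFields.YangMills.Theorems.BalabanUVNodesN19NoLinearPriceSharp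

end
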